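import Summits.MatrixMultiplication.OmegaCensus.USPTilingCheck

/-!
# ω-census, family (b1): a DYNAMIC (most-constrained-first) kernel checker for weak USPs

HONEST FRAMING (pub-omega census; verbatim): lottery ticket; floor = certified bounds/negative ranges.
Census BOOKKEEPING for the (size, width) table of uniquely solvable puzzles (CKSU 2005 §3, "at least two");
plain USPs carry no bound on `ω`; nothing here touches `ω`.

`USPTilingCheck` certifies a USP by the exhaustive tiling search `uspSearch` along a FIXED row order; its
kernel cost is the size of that search tree, which for the engine's 38- and 39-row puzzles of width 7 is
`≈ 8.5·10³` resp. `≈ 5.3·10⁵` nodes under the best static order found — beyond default heartbeats.  This file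
adds the exact analogue with DYNAMIC branching ("Algorithm X" style): at every node the search computes, for
every unassigned row `u` (and, when no row is forced, for every free `σ`-image `v` and free `τ`-image `w`), the
list of still-available tiling triples through it, and branches on the shortest of these lists.  Soundness is
the invariant of `uspSearch_sound` plus one bookkeeping fact: along the quiet pair `(π₂, π₃)` the free images are
EXACTLY the images of the unassigned rows, so branching on an image is complete as well.  For kernel speed the
search runs on plain naturals: rows are `ℕ` indices, the free-image sets are bit masks (`Nat.testBit`, cleared by
`xor 2^b`), and the tiling options of each row come from a literal table `opts : List (List (ℕ × ℕ))` that is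
checked complete once (`uspOptsOK`), so the search never rescans row pairs.

* `dynSearch` / `isUSP_of_dynSearch` — the checker and its soundness (any fuel, any complete option table);
  `dynSearch_step` — one unfolding step, so that a certificate can be SPLIT into one kernel check per
  search-tree node when a single `decide` would exceed the kernel's budget (a full ≈ 5·10²-node search at
  `s = 38` does: "(kernel) excessive memory consumption"; ≈ 10²-node subtrees pass at default heartbeats).
* Instances live in their own files: `USPWidth7S38` (`isUSP_38_7`) and `USPWidth7S39` (`isUSP_39_7`) — the
  engine's USPs of width 7 with 38 and 39 rows, trees of `529` and `794` nodes split into `14` and `39` lemmas —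
  so the census cell reads `39 ≤ s_max^USP(7) ≤ 55` in the kernel (was `37`, `isUSP_37_7`; upper half
  `USPPieceCountBound`).  Not in print (Anderson–Ji–Xu tabulate STRONG USPs only).

References: Cohn–Kleinberg–Szegedy–Umans, FOCS 2005 (arXiv:math/0511460) §3 (USP definition); Anderson–Ji–Xu,
SAT 2020 / arXiv:2301.00074 §3.1 (π₁ = 1; 3D-matching formulation).  The branching rule is Knuth's
minimum-remaining-values choice over rows and images (named only; nothing from it enters a proof).
-/

namespace Summit.MatrixMultiplication.OmegaCensus

open Literature.Computability.AlgebraicComplexity Equiv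

variable {s k : ℕ}

/-! ## Option tables (row indices as naturals) -/

/-- The option table `opts` lists, for every row `u`, every tiling pair `(b, c)` (i.e. `uspTiles row u b c`) as a
pair of naturals: checked by one pass over all row triples, skipping pairs `(u, b)` whose `1`-piece and `2`-piece
meet. [folklore] -/
def uspOptsOK (row : Fin s → Fin k → Fin 3) (opts : List (List (ℕ × ℕ))) : Bool :=
  (List.finRange s).all fun u => (List.finRange s).all fun b =>
    !usp12 row u b || (List.finRange s).all fun c =>
      !uspTiles row u b c || decide (((b : ℕ), (c : ℕ)) ∈ opts.getD u [])

/-- A complete option table lists every tiling pair. [folklore] -/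
theorem mem_opts_of_uspOptsOK {row : Fin s → Fin k → Fin 3} {opts : List (List (ℕ × ℕ))}
    (h : uspOptsOK row opts = true) {u b c : Fin s} (ht : uspTiles row u b c = true) :
    ((b : ℕ), (c : ℕ)) ∈ opts.getD u [] := by
  simp only [uspOptsOK, List.all_eq_true, Bool.or_eq_true, Bool.not_eq_true', decide_eq_true_eq] at h
  have h12 : usp12 row u b = true := by
    simp only [uspTiles, usp12, decide_eq_true_eq] at ht ⊢
    intro i ⟨h0, h1⟩
    exact (ht i).1 (Or.inl ⟨h0, h1⟩)
  rcases h u (List.mem_finRange u) b (List.mem_finRange b) with hn | hall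
  · exact absurd h12 (by rw [hn]; decide)
  rcases hall c (List.mem_finRange c) with hn | hm
  · exact absurd ht (by rw [hn]; decide)
  · exact hm

/-! ## The dynamic search (naturals and bit masks) -/

/-- A branching key: an unassigned row, a free `σ`-image, or a free `τ`-image. [folklore] -/
inductive DynKey where
  | row : ℕ → DynKey
  | imS : ℕ → DynKey
  | imT : ℕ → DynKey
  deriving DecidableEq

/-- Available tiling triples `(u, b, c)`: `u` unassigned, `(b, c)` a listed option of `u`, bit `b` set in the
free-`σ`-image mask `avS`, bit `c` set in `avT`. [folklore] -/
def dynCands (opts : List (List (ℕ × ℕ))) (rest : List ℕ) (avS avT : ℕ) : List (ℕ × ℕ × ℕ) :=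
  rest.flatMap fun u => ((opts.getD u []).filter fun bc => avS.testBit bc.1 && avT.testBit bc.2).map
    fun bc => (u, bc.1, bc.2)

/-- The candidates through a key. [folklore] -/
def dynKeyFilter (cands : List (ℕ × ℕ × ℕ)) : DynKey → List (ℕ × ℕ × ℕ)
  | .row u => cands.filter fun t => t.1 == u
  | .imS v => cands.filter fun t => t.2.1 == v
  | .imT w => cands.filter fun t => t.2.2 == w

/-- Image keys of a node (free images below `n`), with their candidate counts. [folklore] -/
def dynImKeys (n : ℕ) (cands : List (ℕ × ℕ × ℕ)) (avS avT : ℕ) : List (DynKey × ℕ) :=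
  ((List.range n).filter fun v => avS.testBit v).map
      (fun v => (DynKey.imS v, (dynKeyFilter cands (.imS v)).length)) ++
    ((List.range n).filter fun w => avT.testBit w).map
      (fun w => (DynKey.imT w, (dynKeyFilter cands (.imT w)).length))

/-- The most constrained key (fewest candidates) with its count: rows first; images are consulted only when no
row is forced (every row has at least two candidates). [folklore] -/
def dynPick (n : ℕ) (cands : List (ℕ × ℕ × ℕ)) (rest : List ℕ) (avS avT : ℕ) : Option (DynKey × ℕ) :=
  let rowKs := rest.map fun u => (DynKey.row u, (dynKeyFilter cands (.row u)).length)
  let imKs := if rowKs.any fun p => decide (p.2 ≤ 1) then [] else dynImKeys n cands avS avT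
  (rowKs ++ imKs).argmin Prod.snd

/-- Dynamic exhaustive search over partial tiling 3D matchings with fuel: `rest` = unassigned rows, `avS` / `avT`
= bit masks of the free `σ`- / `τ`-images, `moved` = some assigned row got `(σ u, τ u) ≠ (u, u)`.  Value `true` iff
no completion along this enumeration is non-diagonal (fuel exhaustion and an empty key list answer `false`, which
is always safe). [folklore] -/
def dynSearch (n : ℕ) (opts : List (List (ℕ × ℕ))) : ℕ → List ℕ → ℕ → ℕ → Bool → Bool
  | 0, rest, _, _, moved => rest.isEmpty && !moved
  | fuel + 1, rest, avS, avT, moved =>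
      if rest.isEmpty then !moved else
        match dynPick n (dynCands opts rest avS avT) rest avS avT with
        | none => false
        | some kc => (dynKeyFilter (dynCands opts rest avS avT) kc.1).all fun t =>
            dynSearch n opts fuel (rest.erase t.1) (avS ^^^ 2 ^ t.2.1) (avT ^^^ 2 ^ t.2.2)
              (moved || !(t.2.1 == t.1 && t.2.2 == t.1))

/-- **One step of the search, for splitting a certificate across several kernel checks**: a non-leaf node is
`true` as soon as the picked key is known and every child through it is `true`. [folklore] -/
theorem dynSearch_step {n : ℕ} {opts : List (List (ℕ × ℕ))} {fuel : ℕ} {rest : List ℕ} {avS avT : ℕ}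
    {moved : Bool} {kc : DynKey × ℕ} (hne : rest.isEmpty = false)
    (hp : dynPick n (dynCands opts rest avS avT) rest avS avT = some kc)
    (hall : ∀ t ∈ dynKeyFilter (dynCands opts rest avS avT) kc.1,
      dynSearch n opts fuel (rest.erase t.1) (avS ^^^ 2 ^ t.2.1) (avT ^^^ 2 ^ t.2.2)
        (moved || !(t.2.1 == t.1 && t.2.2 == t.1)) = true) :
    dynSearch n opts (fuel + 1) rest avS avT moved = true := by
  simp only [dynSearch, hne, Bool.false_eq_true, if_false, hp, List.all_eq_true]
  exact hall

/-! ## Soundness -/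

/-- A permutation of `Fin s` read on naturals (identity above `s`). [folklore] -/
def permN (π : Perm (Fin s)) (v : ℕ) : ℕ := if h : v < s then ((π ⟨v, h⟩ : Fin s) : ℕ) else v

/-- `permN` agrees with the permutation below `s`. [folklore] -/
theorem permN_val (π : Perm (Fin s)) (v : Fin s) : permN π v = ((π v : Fin s) : ℕ) := by
  simp [permN, v.isLt]

/-- `permN` stays below `s`. [folklore] -/
theorem permN_lt (π : Perm (Fin s)) {v : ℕ} (hv : v < s) : permN π v < s := by
  simp only [permN, hv, dif_pos]; exact Fin.isLt _

/-- `permN` is injective below `s`. [folklore] -/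
theorem permN_inj (π : Perm (Fin s)) {a b : ℕ} (ha : a < s) (hb : b < s) (h : permN π a = permN π b) : a = b := by
  simp only [permN, ha, hb, dif_pos] at h
  have := π.injective (Fin.ext h)
  simpa using this

/-- Membership in the candidate list. [folklore] -/
theorem mem_dynCands {opts : List (List (ℕ × ℕ))} {rest : List ℕ} {avS avT : ℕ} {u b c : ℕ}
    (hu : u ∈ rest) (ho : (b, c) ∈ opts.getD u []) (hb : avS.testBit b = true) (hc : avT.testBit c = true) :
    (u, b, c) ∈ dynCands opts rest avS avT := by
  simp only [dynCands, List.mem_flatMap, List.mem_map, List.mem_filter, Bool.and_eq_true]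
  exact ⟨u, hu, (b, c), ⟨ho, hb, hc⟩, rfl⟩

/-- The picked key is a row of `rest` or a free image. [folklore] -/
theorem dynPick_sound {n : ℕ} {cands : List (ℕ × ℕ × ℕ)} {rest : List ℕ} {avS avT : ℕ} {key : DynKey} {cnt : ℕ}
    (h : dynPick n cands rest avS avT = some (key, cnt)) :
    (∃ u ∈ rest, key = .row u) ∨ (∃ v, avS.testBit v = true ∧ key = .imS v) ∨
      (∃ w, avT.testBit w = true ∧ key = .imT w) := by
  have hm := List.argmin_mem h
  simp only [List.mem_append, List.mem_map] at hm
  rcases hm with ⟨u, hu, e⟩ | him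
  · left; cases e; exact ⟨u, hu, rfl⟩
  · right
    have him' : (key, cnt) ∈ dynImKeys n cands avS avT := by
      revert him; split
      · simp
      · exact id
    simp only [dynImKeys, List.mem_append, List.mem_map, List.mem_filter, List.mem_range] at him'
    rcases him' with ⟨v, ⟨-, hv⟩, e⟩ | ⟨w, ⟨-, hw⟩, e⟩
    · left; cases e; exact ⟨v, hv, rfl⟩
    · right; cases e; exact ⟨w, hw, rfl⟩

/-- Clearing a set bit: membership in the new mask. [folklore] -/
theorem testBit_xor_two_pow {x b w : ℕ} (hb : x.testBit b = true) :
    (x ^^^ 2 ^ b).testBit w = true ↔ x.testBit w = true ∧ w ≠ b := by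
  rw [Nat.testBit_xor, Nat.testBit_two_pow]
  by_cases h : b = w
  · subst h; simp [hb]
  · have : w ≠ b := fun e => h e.symm
    simp [h, this]

/-- **Invariant of the dynamic search.** If `(v, π₂ v, π₃ v)` tiles for every row and the option table is
complete, then at a node whose free-image masks are exactly the images of the unassigned rows,
`dynSearch … moved = true` forces `moved = false` and `π₂ v = v`, `π₃ v = v` on the unassigned rows. [folklore] -/
theorem dynSearch_sound {row : Fin s → Fin k → Fin 3} {opts : List (List (ℕ × ℕ))}
    (hopt : uspOptsOK row opts = true) (π₂ π₃ : Perm (Fin s))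
    (htl : ∀ v, uspTiles row v (π₂ v) (π₃ v) = true) :
    ∀ (fuel : ℕ) (rest : List ℕ) (avS avT : ℕ) (moved : Bool), rest.Nodup → (∀ v ∈ rest, v < s) →
      (∀ w, avS.testBit w = true ↔ ∃ v ∈ rest, permN π₂ v = w) →
      (∀ w, avT.testBit w = true ↔ ∃ v ∈ rest, permN π₃ v = w) →
      dynSearch s opts fuel rest avS avT moved = true →
      moved = false ∧ ∀ v ∈ rest, permN π₂ v = v ∧ permN π₃ v = v
  | 0, rest, avS, avT, moved, _, _, _, _, h => by
      simp only [dynSearch, Bool.and_eq_true, List.isEmpty_iff, Bool.not_eq_true'] at h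
      obtain ⟨rfl, hm⟩ := h
      exact ⟨hm, fun v hv => by simp at hv⟩
  | fuel + 1, rest, avS, avT, moved, hnd, hlt, hS, hT, h => by
      by_cases hemp : rest.isEmpty = true
      · rw [List.isEmpty_iff] at hemp
        subst hemp
        simp only [dynSearch, List.isEmpty_nil, if_true, Bool.not_eq_true'] at h
        exact ⟨h, fun v hv => by simp at hv⟩
      simp only [dynSearch, hemp, if_false, Bool.false_eq_true] at h
      -- the true triple of every unassigned row is a candidate
      have hopt' : ∀ u ∈ rest, (permN π₂ u, permN π₃ u) ∈ opts.getD u [] := fun u hu => by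
        have hu' := hlt u hu
        have := mem_opts_of_uspOptsOK hopt (htl ⟨u, hu'⟩)
        simpa [permN, hu'] using this
      have hcand : ∀ u ∈ rest, (u, permN π₂ u, permN π₃ u) ∈ dynCands opts rest avS avT := fun u hu =>
        mem_dynCands hu (hopt' u hu) ((hS _).2 ⟨u, hu, rfl⟩) ((hT _).2 ⟨u, hu, rfl⟩)
      -- the picked key exists and is sound
      generalize hp : dynPick s (dynCands opts rest avS avT) rest avS avT = p at h
      rcases p with _ | ⟨key, cnt⟩
      · exact absurd h (by simp)
      simp only [List.all_eq_true] at h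
      have hex : ∃ u ∈ rest, (u, permN π₂ u, permN π₃ u) ∈ dynKeyFilter (dynCands opts rest avS avT) key := by
        rcases dynPick_sound hp with ⟨u, hu, rfl⟩ | ⟨v, hv, rfl⟩ | ⟨w, hw, rfl⟩
        · exact ⟨u, hu, List.mem_filter.2 ⟨hcand u hu, by simp⟩⟩
        · obtain ⟨u, hu, e⟩ := (hS v).1 hv
          exact ⟨u, hu, List.mem_filter.2 ⟨hcand u hu, by simp [e]⟩⟩
        · obtain ⟨u, hu, e⟩ := (hT w).1 hw
          exact ⟨u, hu, List.mem_filter.2 ⟨hcand u hu, by simp [e]⟩⟩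
      obtain ⟨u, hu, hmem⟩ := hex
      have hrec := h _ hmem
      simp only at hrec
      -- invariants for the child
      have hnd' : (rest.erase u).Nodup := hnd.erase u
      have hlt' : ∀ v ∈ rest.erase u, v < s := fun v hv => hlt v (List.mem_of_mem_erase hv)
      have hus : u < s := hlt u hu
      have hS' : ∀ w, (avS ^^^ 2 ^ permN π₂ u).testBit w = true ↔ ∃ v ∈ rest.erase u, permN π₂ v = w := by
        intro w
        rw [testBit_xor_two_pow ((hS _).2 ⟨u, hu, rfl⟩), hS]
        constructor
        · rintro ⟨⟨v, hv, rfl⟩, hne⟩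
          exact ⟨v, (List.Nodup.mem_erase_iff hnd).2 ⟨fun e => hne (by rw [e]), hv⟩, rfl⟩
        · rintro ⟨v, hv, rfl⟩
          have hv' := (List.Nodup.mem_erase_iff hnd).1 hv
          exact ⟨⟨v, hv'.2, rfl⟩, fun e => hv'.1 (permN_inj π₂ (hlt v hv'.2) hus e)⟩
      have hT' : ∀ w, (avT ^^^ 2 ^ permN π₃ u).testBit w = true ↔ ∃ v ∈ rest.erase u, permN π₃ v = w := by
        intro w
        rw [testBit_xor_two_pow ((hT _).2 ⟨u, hu, rfl⟩), hT]
        constructor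
        · rintro ⟨⟨v, hv, rfl⟩, hne⟩
          exact ⟨v, (List.Nodup.mem_erase_iff hnd).2 ⟨fun e => hne (by rw [e]), hv⟩, rfl⟩
        · rintro ⟨v, hv, rfl⟩
          have hv' := (List.Nodup.mem_erase_iff hnd).1 hv
          exact ⟨⟨v, hv'.2, rfl⟩, fun e => hv'.1 (permN_inj π₃ (hlt v hv'.2) hus e)⟩
      obtain ⟨hm, hfix⟩ := dynSearch_sound hopt π₂ π₃ htl fuel _ _ _ _ hnd' hlt' hS' hT' hrec
      simp only [Bool.or_eq_false_iff, Bool.not_eq_eq_eq_not, Bool.not_false, Bool.and_eq_true,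
        beq_iff_eq] at hm
      obtain ⟨hm0, hbu, hcu⟩ := hm
      refine ⟨hm0, fun v hv => ?_⟩
      by_cases hvu : v = u
      · subst hvu; exact ⟨hbu, hcu⟩
      · exact hfix v ((List.Nodup.mem_erase_iff hnd).2 ⟨hvu, hv⟩)

/-- **Soundness of the dynamic checker**: a complete option table and a successful `dynSearch` from the root
(all `s` rows unassigned, both masks `2^s − 1`, any fuel) certify `IsUSP row` (CKSU 2005 §3, "at least two").
[cite: CohnKleinbergSzegedyUmans2005, §3 (p. 5)] [cite: AndersonJiXu2020, §3.1] -/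
theorem isUSP_of_dynSearch {row : Fin s → Fin k → Fin 3} {opts : List (List (ℕ × ℕ))} {fuel : ℕ}
    (hopt : uspOptsOK row opts = true)
    (h : dynSearch s opts fuel (List.range s) (2 ^ s - 1) (2 ^ s - 1) false = true) :
    IsUSP row := by
  rw [isUSP_iff_fix_first]
  intro π₂ π₃
  by_cases hex : ∃ u : Fin s, ∃ i : Fin k, USPAtLeastTwo (row u i) (row (π₂ u) i) (row (π₃ u) i)
  · exact Or.inr hex
  · left
    simp only [not_exists] at hex
    have hcov := IsUSP.cover_of_quiet (row := row) π₂ π₃ hex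
    have htl : ∀ v, uspTiles row v (π₂ v) (π₃ v) = true := fun v => by
      simp only [uspTiles, decide_eq_true_eq]; exact fun i => ⟨hex v i, hcov v i⟩
    have hinit : ∀ (π : Perm (Fin s)) (w : ℕ),
        (2 ^ s - 1).testBit w = true ↔ ∃ v ∈ List.range s, permN π v = w := by
      intro π w
      rw [Nat.testBit_two_pow_sub_one, decide_eq_true_eq]
      constructor
      · intro hw
        refine ⟨((π⁻¹ ⟨w, hw⟩ : Fin s) : ℕ), List.mem_range.2 (Fin.isLt _), ?_⟩
        rw [permN_val]; simp
      · rintro ⟨v, hv, rfl⟩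
        exact permN_lt π (List.mem_range.1 hv)
    obtain ⟨-, hfix⟩ := dynSearch_sound hopt π₂ π₃ htl fuel _ _ _ false List.nodup_range
      (fun v hv => List.mem_range.1 hv) (hinit π₂) (hinit π₃) h
    have key : ∀ (π : Perm (Fin s)), (∀ v ∈ List.range s, permN π v = v) → π = 1 := fun π hπ =>
      Equiv.ext fun v => Fin.ext (by
        have := hπ v (List.mem_range.2 v.isLt)
        rwa [permN_val] at this)
    exact ⟨key π₂ fun v hv => (hfix v hv).1, key π₃ fun v hv => (hfix v hv).2⟩

end Summit.MatrixMultiplication.OmegaCensus
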